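import Summits.BirchSwinnertonDyer.BirchSwinnertonDyer.Theorems.AdditiveKolyvaginRoadManinFrameResidueProperRTameTwistKPTwistDegree
import HarnessLib

/-!
# Route `AdditiveKolyvaginRoad`, crux `ManinFrameResidueProperR` (stmt-BirchSwinnertonDyer-20709), line
# `tame-twist`: the narrowed research stub S57-T of skeleton v3 ⟸ F″ + the twist-degree step at the frame curve;
# and route EdixhovenFibreFiveSeven's TDS57 OFF the Kosters–Pannekoek locus ⟸ F″ (`--supports`, helper)

Cell `pub/bsd-wall`, seat `bsd-wall-manin-p1` g5. THEOREMS ONLY; nothing is closed. Part 2 of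
`…RTameTwistKPTwistDegree` (the `p ∈ {5, 7}` translation S57 ⟺ (TDS) on the Kosters–Pannekoek locus, granted the
Kato–Kosters–Pannekoek fact F″, Dokchitser–Dokchitser and modularity):

* §4 `kpLocus_of_exists_member_torsion` — a class with a local-`p`-torsion member sits on Kodaira II/III at `5`,
  II at `7` (contrapositive of `forall_member_noPTorsion_of_kodaira_of_exists_member`);
  `stub_memberManinUnit_fiveSeven_KP_of_twistDegreeStep57` (Kodaira-locus form) and
  `stub_memberManinUnit_fiveSeven_torsion_of_twistDegreeStep57` — **the narrowed research stub S57-T of skeleton v3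
  (binders VERBATIM: `dd hnf W p hp5 hp11 hadd hirr hres hall hT`) from F″ and the twist-degree step AT THE FRAME
  CURVE `W` ITSELF** (on the locus `W` is unstarred and, by the residue clause, potentially good:
  `padicValRat_j_nonneg_of_addv_of_exists_member`); `twistDegreeStep57_of_memberManinUnit` — the converse.
* §5 `twistDegreeStepFiveSeven_offKP_of_kato` — **route EdixhovenFibreFiveSeven's crux TDS57
  (`TwistDegreeStepFiveSeven`, stmt-BirchSwinnertonDyer-22227) HOLDS OFF the Kosters–Pannekoek locus, granted F″,
  DD and modularity**: for unstarred `V` of type IV at `5`, III/IV at `7` the class of `V` is Manin-good by the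
  `p ∈ {5, 7}` lever (no member has local `p`-torsion), and the converse reading of the twist identity gives the
  degree inequality. So BOTH routes' `p ∈ {5, 7}` residue, modulo the Kato fact, is the twist-degree step on
  {II/III@5, II@7} (KP57-CENSUS-v1: 49 exceptional classes among 1 159 residue cells with `N ≤ 5·10⁵`).

BSD is not proved by any of this. References: [EdixhovenManin1991] §4; [Kato2004Asterisque] Thm. 9.7;
[KostersPannekoek2017] Thm. 1, Cor. 2; [DokchitserDokchitser2015LocalInvariants] Thm. 5.1 (1); [Mazur1977] III §5;
[ZagierCMB1985] §1.
-/

set_option autoImplicit false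
set_option linter.dupNamespace false

noncomputable section

open scoped Classical

open WeierstrassCurve NumberField Literature.NumberTheory.EllipticCurves
  Literature.NumberTheory.EllipticCurves.ModularForms
  Literature.NumberTheory.EllipticCurves.Rank1Residual
  Literature.NumberTheory.DiophantineGeometry IsDedekindDomain Rat.HeightOneSpectrum
  Summit.BirchSwinnertonDyer.Rank1Residual Summit.BirchSwinnertonDyer.Rank1Residual.Additive

namespace Summit.BirchSwinnertonDyer.BirchSwinnertonDyer.Theorems.ManinFrameResidueProperRTameTwist

/-! ### §4 The narrowed research stub S57-KP of skeleton v3, from F″ and the twist-degree step at the frame curve -/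

section KP

variable {p : ℕ} [hp : Fact p.Prime]

omit hp in
/-- On the Kosters–Pannekoek locus the frame curve is unstarred: `v_p(Δ_min W) < 6`. [folklore] -/
theorem padicValInt_minimalDiscriminantInt_lt_six_of_KP (W : WeierstrassCurve ℚ) [W.IsElliptic]
    [W.IsGloballyMinimal]
    (hKP : (p = 5 ∧ (padicValInt p W.minimalDiscriminantInt = 2 ∨
        padicValInt p W.minimalDiscriminantInt = 3)) ∨ (p = 7 ∧ padicValInt p W.minimalDiscriminantInt = 2)) :
    padicValInt p W.minimalDiscriminantInt < 6 := by
  rcases hKP with ⟨-, h | h⟩ | ⟨-, h⟩ <;> omega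

/-- **S57-KP from the twist-degree step at the frame curve** (`p ∈ {5, 7}`): the binders of the narrowed stub
`…Cruxes.ManinFrameResidueProperR.TameTwist.stub_memberManinUnit_fiveSeven_KP` of skeleton v3 VERBATIM
(`dd hnf W p hp5 hp11 hadd hirr hres hall hKP`), preceded by the Kato fact `hK` (= the other stub F″ of the line)
and followed by the CURVE-LEVEL twist-degree step `hStep`: for every globally minimal model `W♭` of
`W ⊗ χ_{p*}` some conductor-level datum `D` of `W` has `v_p(deg D) < v_p(deg D♭)` for every conductor-level
datum `D♭` of `W♭`. On the KP locus `W` itself is unstarred (`v_p(Δ_min W) ≤ 3`) and potentially good by the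
residue clause (`padicValRat_j_nonneg_of_addv_of_exists_member`), so §3 applies with `V = W`. CONDITIONAL on
`hStep` (Manin's conjecture on this locus in Edixhoven's degree form, NOT in print) — a translation, not a closure.
[cite: EdixhovenManin1991, §4 (cases 1/2)] [cite: Kato2004Asterisque, Thm. 9.7 (p. 189)]
[cite: DokchitserDokchitser2015LocalInvariants, Thm. 5.1 (1)] -/
theorem stub_memberManinUnit_fiveSeven_KP_of_twistDegreeStep57
    (hK : kato_neron_isIntegral_twistedSymbolSum_of_additive_five_le)
    (dd : dokchitser_padicValInt_minimalDiscriminantInt_eq_of_isogeny_of_not_dvd_degree)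
    (hnf : Literature.NumberTheory.EllipticCurves.ModularForms.exists_isNewformOf)
    (W : WeierstrassCurve ℚ) [W.IsElliptic] [W.IsGloballyMinimal] (hp5 : 5 ≤ p) (hp11 : p < 11)
    [NeZero (W.conductorNorm ℤ)] (hadd : Addv W p) (hirr : Irr W p)
    (hres : ((p < 11 ∨ ∃ (W' : WeierstrassCurve ℚ) (_ : W'.IsElliptic) (_ : W'.IsGloballyMinimal),
          IsIsogenous W W' ∧ TypeGOrd W' p ∧ padicValInt p W'.minimalDiscriminantInt ≤ 4) ∧
        (∃ (W' : WeierstrassCurve ℚ) (_ : W'.IsElliptic) (_ : W'.IsGloballyMinimal),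
          IsIsogenous W W' ∧ ∀ (v : HeightOneSpectrum ℤ) (n : ℕ), natGenerator v = p →
            W'.kodairaSymbolAt v ≠ KodairaSymbol.Istar n)))
    (_hall : (∀ (W' : WeierstrassCurve ℚ) [W'.IsElliptic] [W'.IsGloballyMinimal]
          (D' : ModularParametrizationData W' (W.conductorNorm ℤ)),
          IsIsogenous W W' → p ∣ D'.modularDegree))
    (hKP : (p = 5 ∧ (padicValInt p W.minimalDiscriminantInt = 2 ∨
        padicValInt p W.minimalDiscriminantInt = 3)) ∨ (p = 7 ∧ padicValInt p W.minimalDiscriminantInt = 2))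
    (hStep : ∀ (Wf : WeierstrassCurve ℚ) [Wf.IsElliptic] [Wf.IsGloballyMinimal] [NeZero (Wf.conductorNorm ℤ)]
        (C : VariableChange ℚ), C • W.quadraticTwist ((-1 : ℚ) ^ (p / 2) * p) = Wf →
        ∃ D : ModularParametrizationData W (W.conductorNorm ℤ),
          ∀ Df : ModularParametrizationData Wf (Wf.conductorNorm ℤ),
            padicValNat p D.modularDegree < padicValNat p Df.modularDegree) :
    ∃ (W₀ : WeierstrassCurve ℚ) (_ : W₀.IsElliptic) (_ : W₀.IsGloballyMinimal)
        (D₀ : ModularParametrizationData W₀ (W.conductorNorm ℤ)),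
        IsIsogenous W W₀ ∧ ¬ (p : ℤ) ∣ D₀.c := by
  have hp57 : p = 5 ∨ p = 7 := by
    rcases hKP with ⟨h, -⟩ | ⟨h, -⟩
    · exact Or.inl h
    · exact Or.inr h
  have hp2 : p ≠ 2 := by omega
  have hj : 0 ≤ padicValRat p W.j := padicValRat_j_nonneg_of_addv_of_exists_member W hp2 hadd hres.2
  have hV6 : padicValInt p W.minimalDiscriminantInt < 6 := padicValInt_minimalDiscriminantInt_lt_six_of_KP W hKP
  obtain ⟨Wf, hEf, hMf, C, hC⟩ := exists_minimal_twist_pStar p W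
  haveI := hEf
  haveI := hMf
  haveI : NeZero (Wf.conductorNorm ℤ) := ⟨(Wf.conductorNorm_pos_holds).ne'⟩
  exact exists_member_not_dvd_c_of_twistDegreeStep57 hK dd hnf W hp57 hadd hirr
    (isIsogenous_self W) hj hV6 C hC (hStep Wf C hC)

/-- **A class with a local-`p`-torsion member lies on the Kosters–Pannekoek Kodaira locus.** For `W/ℚ` globally
minimal, additive at `p ≥ 5`, `E[p]` irreducible, with the residue clause «some member has no `Iₙ*` fibre at `p`»,
GRANTED Dokchitser–Dokchitser: if some globally minimal `W′ ∼ W` has a `ℚ_p`-rational point `P ≠ 0` with `p • P = 0`,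
then `(p = 5 ∧ v₅(Δ_min W) ∈ {2, 3}) ∨ (p = 7 ∧ v₇(Δ_min W) = 2)` (contrapositive of
`forall_member_noPTorsion_of_kodaira_of_exists_member`: Mazur's Step 1 at `p ≥ 5`, sharp form, on `W′`, moved to
`W` by DD under `Irr`). [cite: Mazur1977, Ch. III §5, Step 1, p. 158]
[cite: DokchitserDokchitser2015LocalInvariants, Thm. 5.1 (1)] [cite: KostersPannekoek2017, Thm. 1 and Cor. 2] -/
theorem kpLocus_of_exists_member_torsion
    (hDD : dokchitser_padicValInt_minimalDiscriminantInt_eq_of_isogeny_of_not_dvd_degree)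
    (W : WeierstrassCurve ℚ) [W.IsElliptic] [W.IsGloballyMinimal] (hp5 : 5 ≤ p) (hadd : Addv W p)
    (hirr : Irr W p)
    (hres : ∃ (W' : WeierstrassCurve ℚ) (_ : W'.IsElliptic) (_ : W'.IsGloballyMinimal),
      IsIsogenous W W' ∧ ∀ (v : HeightOneSpectrum ℤ) (n : ℕ), natGenerator v = p →
        W'.kodairaSymbolAt v ≠ KodairaSymbol.Istar n)
    (hT : ∃ (W' : WeierstrassCurve ℚ) (_ : W'.IsElliptic) (_ : W'.IsGloballyMinimal),
      IsIsogenous W W' ∧ ∃ P : (W'.baseChange ℚ_[p]).toAffine.Point, p • P = 0 ∧ P ≠ 0) :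
    (p = 5 ∧ (padicValInt p W.minimalDiscriminantInt = 2 ∨
        padicValInt p W.minimalDiscriminantInt = 3)) ∨ (p = 7 ∧ padicValInt p W.minimalDiscriminantInt = 2) := by
  obtain ⟨W', hE', hM', hiso, P, hP, hP0⟩ := hT
  by_contra hexc
  exact hP0 (forall_member_noPTorsion_of_kodaira_of_exists_member hDD W hp5 hadd hirr hres hexc W' hiso P hP)

/-- **S57-T from the twist-degree step at the frame curve** (`p ∈ {5, 7}`): the binders of the narrowed research
stub `…Cruxes.ManinFrameResidueProperR.TameTwist.stub_memberManinUnit_fiveSeven_torsion` of skeleton v3 VERBATIM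
(`dd hnf W p hp5 hp11 hadd hirr hres hall hT`), preceded by the Kato fact `hK` (= the other stub F″ of the line) and
followed by the CURVE-LEVEL twist-degree step `hStep` at `W`: for every globally minimal model `W♭` of `W ⊗ χ_{p*}`
some conductor-level datum `D` of `W` has `v_p(deg D) < v_p(deg D♭)` for every conductor-level datum `D♭` of
`W♭`. The torsion member puts the class on the Kodaira locus II/III@5, II@7 (`kpLocus_of_exists_member_torsion`)
and `stub_memberManinUnit_fiveSeven_KP_of_twistDegreeStep57` concludes. CONDITIONAL on `hStep` — a translation of
the stub, not a closure. [cite: EdixhovenManin1991, §4 (cases 1/2)] [cite: Kato2004Asterisque, Thm. 9.7 (p. 189)]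
[cite: DokchitserDokchitser2015LocalInvariants, Thm. 5.1 (1)] -/
theorem stub_memberManinUnit_fiveSeven_torsion_of_twistDegreeStep57
    (hK : kato_neron_isIntegral_twistedSymbolSum_of_additive_five_le)
    (dd : dokchitser_padicValInt_minimalDiscriminantInt_eq_of_isogeny_of_not_dvd_degree)
    (hnf : Literature.NumberTheory.EllipticCurves.ModularForms.exists_isNewformOf)
    (W : WeierstrassCurve ℚ) [W.IsElliptic] [W.IsGloballyMinimal] (hp5 : 5 ≤ p) (hp11 : p < 11)
    [NeZero (W.conductorNorm ℤ)] (hadd : Addv W p) (hirr : Irr W p)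
    (hres : ((p < 11 ∨ ∃ (W' : WeierstrassCurve ℚ) (_ : W'.IsElliptic) (_ : W'.IsGloballyMinimal),
          IsIsogenous W W' ∧ TypeGOrd W' p ∧ padicValInt p W'.minimalDiscriminantInt ≤ 4) ∧
        (∃ (W' : WeierstrassCurve ℚ) (_ : W'.IsElliptic) (_ : W'.IsGloballyMinimal),
          IsIsogenous W W' ∧ ∀ (v : HeightOneSpectrum ℤ) (n : ℕ), natGenerator v = p →
            W'.kodairaSymbolAt v ≠ KodairaSymbol.Istar n)))
    (hall : (∀ (W' : WeierstrassCurve ℚ) [W'.IsElliptic] [W'.IsGloballyMinimal]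
          (D' : ModularParametrizationData W' (W.conductorNorm ℤ)),
          IsIsogenous W W' → p ∣ D'.modularDegree))
    (hT : ∃ (W' : WeierstrassCurve ℚ) (_ : W'.IsElliptic) (_ : W'.IsGloballyMinimal),
      IsIsogenous W W' ∧ ∃ P : (W'.baseChange ℚ_[p]).toAffine.Point, p • P = 0 ∧ P ≠ 0)
    (hStep : ∀ (Wf : WeierstrassCurve ℚ) [Wf.IsElliptic] [Wf.IsGloballyMinimal] [NeZero (Wf.conductorNorm ℤ)]
        (C : VariableChange ℚ), C • W.quadraticTwist ((-1 : ℚ) ^ (p / 2) * p) = Wf →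
        ∃ D : ModularParametrizationData W (W.conductorNorm ℤ),
          ∀ Df : ModularParametrizationData Wf (Wf.conductorNorm ℤ),
            padicValNat p D.modularDegree < padicValNat p Df.modularDegree) :
    ∃ (W₀ : WeierstrassCurve ℚ) (_ : W₀.IsElliptic) (_ : W₀.IsGloballyMinimal)
        (D₀ : ModularParametrizationData W₀ (W.conductorNorm ℤ)),
        IsIsogenous W W₀ ∧ ¬ (p : ℤ) ∣ D₀.c :=
  stub_memberManinUnit_fiveSeven_KP_of_twistDegreeStep57 hK dd hnf W hp5 hp11 hadd hirr hres hall
    (kpLocus_of_exists_member_torsion dd W hp5 hadd hirr hres.2 hT) hStep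

/-- **Conversely, S57's conclusion ⟹ the twist-degree step at the frame curve** on the Kosters–Pannekoek locus
(only modularity is used): if some globally minimal `W₀ ∼ W` has a datum at level `N(W)` with `p ∤ c`, then for
every globally minimal model `W♭` of `W ⊗ χ_{p*}` some conductor-level datum `D` of `W` has
`v_p(deg D) < v_p(deg D♭)` for all conductor-level data `D♭` of `W♭`. With the previous theorem: **on the KP
locus, S57 ⟺ (TDS at the frame curve)**, granted `hnf`, F″, DD. [cite: ZagierCMB1985, §1 (p. 374)]
[cite: Pal2012, Prop. 2.5] -/
theorem twistDegreeStep57_of_memberManinUnit (hnf : exists_isNewformOf)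
    (W : WeierstrassCurve ℚ) [W.IsElliptic] [W.IsGloballyMinimal] [NeZero (W.conductorNorm ℤ)]
    (hp5 : 5 ≤ p) (hadd : Addv W p) (hirr : Irr W p)
    (hres : ∃ (W' : WeierstrassCurve ℚ) (_ : W'.IsElliptic) (_ : W'.IsGloballyMinimal),
      IsIsogenous W W' ∧ ∀ (v : HeightOneSpectrum ℤ) (n : ℕ), natGenerator v = p →
        W'.kodairaSymbolAt v ≠ KodairaSymbol.Istar n)
    (hKP : (p = 5 ∧ (padicValInt p W.minimalDiscriminantInt = 2 ∨
        padicValInt p W.minimalDiscriminantInt = 3)) ∨ (p = 7 ∧ padicValInt p W.minimalDiscriminantInt = 2))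
    (h : ∃ (W₀ : WeierstrassCurve ℚ) (_ : W₀.IsElliptic) (_ : W₀.IsGloballyMinimal)
        (D₀ : ModularParametrizationData W₀ (W.conductorNorm ℤ)),
        IsIsogenous W W₀ ∧ ¬ (p : ℤ) ∣ D₀.c)
    (Wf : WeierstrassCurve ℚ) [Wf.IsElliptic] [Wf.IsGloballyMinimal] [NeZero (Wf.conductorNorm ℤ)]
    (C : VariableChange ℚ) (hC : C • W.quadraticTwist ((-1 : ℚ) ^ (p / 2) * p) = Wf) :
    ∃ D : ModularParametrizationData W (W.conductorNorm ℤ),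
      ∀ Df : ModularParametrizationData Wf (Wf.conductorNorm ℤ),
        padicValNat p D.modularDegree < padicValNat p Df.modularDegree := by
  have hp2 : p ≠ 2 := by omega
  have hj : 0 ≤ padicValRat p W.j := padicValRat_j_nonneg_of_addv_of_exists_member W hp2 hadd hres
  have hV6 : padicValInt p W.minimalDiscriminantInt < 6 := padicValInt_minimalDiscriminantInt_lt_six_of_KP W hKP
  exact twistDegreeStep57_of_exists_member_not_dvd_c hnf W hp5 hadd hirr (isIsogenous_self W) hj hV6
    C hC h

end KP

/-! ### §5 Route EdixhovenFibreFiveSeven's crux TDS57 OFF the Kosters–Pannekoek locus, from the Kato fact -/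

section OffKP

variable {p : ℕ} [hp : Fact p.Prime]

/-- **The twist-degree step TDS57 holds OFF the Kosters–Pannekoek locus, granted F″, DD and modularity.** The
binders of route EdixhovenFibreFiveSeven's crux `TwistDegreeStepFiveSeven` (stmt-BirchSwinnertonDyer-22227) after
its modularity antecedent — `p ∈ {5, 7}`, `V/ℚ` globally minimal, additive at `p` with no `Iₙ*` fibre,
`v_p(Δ_min V) ≤ 4`, `E[p]` irreducible, `W♭` a globally minimal model of `V ⊗ χ_{p*}` — PLUS the off-locus clause
`¬ ((p = 5 ∧ v₅(Δ_min V) ∈ {2, 3}) ∨ (p = 7 ∧ v₇(Δ_min V) = 2))` (i.e. type IV at `5`; III or IV at `7`):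
some conductor-level datum `D` of `V` has `v_p(deg D) < v_p(deg D♭)` for every conductor-level datum `D♭` of
`W♭`. Proof: the class of `V` has no member with local `p`-torsion (Mazur's Step 1 + DD), so the `p ∈ {5, 7}`
tame-twist lever gives a member with a Manin-unit datum (`exists_member_not_dvd_c_of_tameTwist57_of_kodaira`),
and §3's converse reading (`twistDegreeStep57_of_exists_member_not_dvd_c`, only the twist identity) turns it into
the degree inequality. Hence crux 22227's content beyond the Kato fact is the locus {II/III@5, II@7} — the same
residual as AKR's S57-T. Nothing is closed (F″ is statement-only). [cite: Kato2004Asterisque, Thm. 9.7 (p. 189)]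
[cite: KostersPannekoek2017, Thm. 1 and Cor. 2] [cite: ZagierCMB1985, §1 (p. 374)]
[cite: DokchitserDokchitser2015LocalInvariants, Thm. 5.1 (1)] -/
theorem twistDegreeStepFiveSeven_offKP_of_kato
    (hK : kato_neron_isIntegral_twistedSymbolSum_of_additive_five_le)
    (hDD : dokchitser_padicValInt_minimalDiscriminantInt_eq_of_isogeny_of_not_dvd_degree)
    (hnf : exists_isNewformOf)
    (V : WeierstrassCurve ℚ) [V.IsElliptic] [V.IsGloballyMinimal] [NeZero (V.conductorNorm ℤ)]
    (Wf : WeierstrassCurve ℚ) [Wf.IsElliptic] [Wf.IsGloballyMinimal] [NeZero (Wf.conductorNorm ℤ)]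
    (C : VariableChange ℚ) (hp57 : p = 5 ∨ p = 7) (hV : Addv V p) (hirrV : Irr V p)
    (hKod : ∀ (v : HeightOneSpectrum ℤ) (n : ℕ), natGenerator v = p →
      V.kodairaSymbolAt v ≠ KodairaSymbol.Istar n)
    (hV4 : padicValInt p V.minimalDiscriminantInt ≤ 4)
    (hexc : ¬ ((p = 5 ∧ (padicValInt p V.minimalDiscriminantInt = 2 ∨
        padicValInt p V.minimalDiscriminantInt = 3)) ∨ (p = 7 ∧ padicValInt p V.minimalDiscriminantInt = 2)))
    (hC : C • V.quadraticTwist ((-1 : ℚ) ^ (p / 2) * p) = Wf) :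
    ∃ D : ModularParametrizationData V (V.conductorNorm ℤ),
      ∀ Df : ModularParametrizationData Wf (Wf.conductorNorm ℤ),
        padicValNat p D.modularDegree < padicValNat p Df.modularDegree := by
  have hp5 : 5 ≤ p := by rcases hp57 with rfl | rfl <;> norm_num
  have hp2 : p ≠ 2 := by omega
  have hv₀ : natGenerator ((primesEquiv (R := ℤ)).symm ⟨p, hp.out⟩) = p :=
    congrArg Subtype.val ((primesEquiv (R := ℤ)).apply_symm_apply ⟨p, hp.out⟩)
  have hj : 0 ≤ padicValRat p V.j :=
    padicValRat_j_nonneg_of_addv_of_forall_kodairaSymbolAt_ne_Istar V hp2 hV _ hv₀ (fun n ↦ hKod _ n hv₀)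
  -- the class of `V` is Manin-good: no member has local `p`-torsion off the locus
  have hmem := exists_member_not_dvd_c_of_tameTwist57_of_kodaira hK hDD hnf V hp57 hV hirrV hj hexc
  exact twistDegreeStep57_of_exists_member_not_dvd_c hnf V hp5 hV hirrV (isIsogenous_self V) hj (by omega) C hC
    hmem

end OffKP

end Summit.BirchSwinnertonDyer.BirchSwinnertonDyer.Theorems.ManinFrameResidueProperRTameTwist

end
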